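import Literature.NumberTheory.LFunctions.Zhang2022.DetectorShiftDoubledParseval

/-!
# Zhang (2022) detector main-term forms — pointwise Fourier inversion on the period cell and summability of the
# cell transform from the derivative rule (analysis leaf for the OFF-BOX slot instance, cell landau-siegel §E, K11)

Y. Zhang, *Discrete mean estimates and the Landau–Siegel zero*, arXiv:2211.02515v1 (2022) [Zhang2022LandauSiegel] —
an unrefereed manuscript under adjudication. **WHAT THIS IS NOT: a claim about its Theorems 1–2, about Landau–Siegel
zeros, about Parity, or about a repaired `Margin232`. The programme SEARCHES and TYPES; no claim about Landau–Siegel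
zeros, Theorems 1–2 of arXiv:2211.02515 or a repaired Margin232 until a kernel theorem says so.**

Pure analysis on the cell transform `Det.dpiece c (c+2) S m = ∫_c^{c+2} S e^{−iπm·}` of `DetectorShiftDoubledParseval`
(the circle / doubling chains use only Parseval; the off-box slot instance needs POINTWISE values):

* `Det.hasSum_dpiece_pointwise` — for `S` continuous on `[c, c+2]`, periodic `S c = S (c+2)`, with summable transform,
  `S y = ½ Σ_m D_S(m) e^{iπmy}` at every `y ∈ [c, c+2]` (Mathlib `has_pointwise_sum_fourier_series_of_summable` transported
  along `AddCircle.liftIco` / `fourierCoeff_liftIco_eq` / `Det.fourierCoeffOn_cell_eq'`);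
* `Det.summable_norm_dpiece_of_rule` — if `D_{S′}(m) = iπm·D_S(m)` for all `m` and `S′ ∈ L²(c, c+2]`, then `Σ_m ‖D_S(m)‖ < ∞`
  (Bessel for `S′` and `ab ≤ (a² + b²)/2`).

References: Y. Katznelson, *An introduction to harmonic analysis*, 3rd ed. (2004), Ch. I §§2–3, §5 [Katznelson2004];
Y. Zhang, arXiv:2211.02515v1, Prop. 7.1 p.44 with (7.2), §8 (8.11)–(8.23). [cite: Zhang2022LandauSiegel, Prop 7.1 p.44 with (7.2), (8.11)–(8.23)]
-/

noncomputable section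

open Complex Real Set intervalIntegral Filter Topology
open _root_.MeasureTheory
open scoped ComplexConjugate

namespace Literature.NumberTheory.LFunctions.Zhang2022

namespace Det

variable {c : ℝ} {S S' : ℝ → ℂ}

/-- **Pointwise Fourier inversion on the period cell.** For `S` continuous on `[c, c+2]` with `S c = S (c+2)` and
`Σ_m ‖D_S(m)‖ < ∞` (`D_S(m) = ∫_c^{c+2} S e^{−iπm·}`): `HasSum (m ↦ ½·D_S(m)·e^{iπmy}) (S y)` for every `y ∈ [c, c+2]`.
[cite: Katznelson2004, Ch. I §3.1 (absolutely convergent Fourier series)] -/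
theorem hasSum_dpiece_pointwise (hS : ContinuousOn S (Icc c (c + 2))) (hper : S c = S (c + 2))
    (hsum : Summable fun m : ℤ => ‖dpiece c (c + 2) S m‖) {y : ℝ} (hy : y ∈ Icc c (c + 2)) :
    HasSum (fun m : ℤ => (1 / 2 : ℂ) * dpiece c (c + 2) S m * cexp (I * π * m * y)) (S y) := by
  haveI : Fact ((0:ℝ) < 2) := ⟨two_pos⟩
  -- the continuous lift to the circle of period 2
  set F : C(AddCircle (2:ℝ), ℂ) :=
    ⟨AddCircle.liftIco 2 c S, AddCircle.liftIco_continuous (by simpa using hper) (by simpa using hS)⟩ with hF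
  have hcoef : ∀ m : ℤ, fourierCoeff F m = (1 / 2 : ℂ) * dpiece c (c + 2) S m := by
    intro m
    have h1 : fourierCoeff F m = fourierCoeff (AddCircle.liftIco 2 c S) m := rfl
    rw [h1, fourierCoeff_liftIco_eq]
    exact fourierCoeffOn_cell_eq' c S m
  have hsumF : Summable (fourierCoeff F) := by
    refine Summable.of_norm ?_
    have : (fun m : ℤ => ‖fourierCoeff F m‖) = fun m => (1 / 2 : ℝ) * ‖dpiece c (c + 2) S m‖ := by
      funext m; rw [hcoef, norm_mul]; norm_num
    rw [this]
    exact hsum.mul_left _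
  -- the point of the circle and the value of the lift there
  have hval : ∀ {x : ℝ}, x ∈ Ico c (c + 2) → F (x : AddCircle (2:ℝ)) = S x := fun hx => by
    show AddCircle.liftIco 2 c S _ = _
    exact AddCircle.liftIco_coe_apply hx
  rcases eq_or_lt_of_le hy.2 with hyc | hyc
  · -- `y = c + 2`: the same point of the circle as `c`
    have hpt : ((y : ℝ) : AddCircle (2:ℝ)) = (c : AddCircle (2:ℝ)) := by
      rw [hyc]; exact AddCircle.coe_add_period 2 c
    have h := has_pointwise_sum_fourier_series_of_summable hsumF (c : AddCircle (2:ℝ))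
    rw [hval ⟨le_rfl, by linarith⟩, hper, ← hyc] at h
    refine h.congr_fun fun m => ?_
    rw [hcoef, smul_eq_mul, ← hpt, fourier_coe_apply]
    congr 1
    congr 1
    push_cast
    ring
  · have h := has_pointwise_sum_fourier_series_of_summable hsumF (y : AddCircle (2:ℝ))
    rw [hval ⟨hy.1, hyc⟩] at h
    refine h.congr_fun fun m => ?_
    rw [hcoef, smul_eq_mul, fourier_coe_apply]
    congr 1
    congr 1
    push_cast
    ring

/-- **Bessel on the cell**: for `u ∈ L²(c, c+2]`, `Σ_m ‖D_u(m)‖²` is summable. [cite: Katznelson2004, Ch. I §5.5 (Bessel's inequality)] -/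
theorem summable_normSq_dpiece (c : ℝ) {u : ℝ → ℂ} (hu : MemLp u 2 (volume.restrict (Ioc c (c + 2)))) :
    Summable fun m : ℤ => ‖dpiece c (c + 2) u m‖ ^ 2 := by
  have h := hasSum_conj_dpiece_cell_mul c hu hu
  have h2 : (fun m : ℤ => conj (dpiece c (c + 2) u m) * dpiece c (c + 2) u m)
      = fun m : ℤ => (((‖dpiece c (c + 2) u m‖ ^ 2 : ℝ)) : ℂ) := by
    funext m; rw [Complex.conj_mul', Complex.ofReal_pow]
  rw [h2] at h
  have h3 := Complex.hasSum_re h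
  simp only [Complex.ofReal_re] at h3
  exact h3.summable

/-- **Summability of the cell transform from the derivative rule.** If `D_{S′}(m) = iπm·D_S(m)` for every `m` and
`S′ ∈ L²(c, c+2]`, then `Σ_m ‖D_S(m)‖ < ∞` (for `m ≠ 0`: `‖D_S(m)‖ = ‖D_{S′}(m)‖/(π|m|) ≤ (‖D_{S′}(m)‖² + (πm)⁻²)/2`).
[cite: Katznelson2004, Ch. I §5.5; Ch. I §3.1] -/
theorem summable_norm_dpiece_of_rule (c : ℝ) (hS'm : MemLp S' 2 (volume.restrict (Ioc c (c + 2))))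
    (hd1 : ∀ m : ℤ, dpiece c (c + 2) S' m = I * π * m * dpiece c (c + 2) S m) :
    Summable fun m : ℤ => ‖dpiece c (c + 2) S m‖ := by
  have hB := summable_normSq_dpiece c hS'm
  have hZ : Summable fun m : ℤ => 1 / (m : ℝ) ^ 2 := summable_one_div_int_pow.2 one_lt_two
  -- majorant `g m = (‖D_{S′}(m)‖² + (π m)⁻²)/2` for `m ≠ 0`, and the value itself at `m = 0`
  set g : ℤ → ℝ := fun m => if m = 0 then ‖dpiece c (c + 2) S 0‖
    else (‖dpiece c (c + 2) S' m‖ ^ 2 + 1 / π ^ 2 * (1 / (m : ℝ) ^ 2)) / 2 with hg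
  have hgs : Summable g := by
    have hmaj : Summable fun m : ℤ => (‖dpiece c (c + 2) S' m‖ ^ 2 + 1 / π ^ 2 * (1 / (m : ℝ) ^ 2)) / 2 :=
      ((hB.add (hZ.mul_left _)).div_const 2)
    refine (hmaj.add (summable_of_ne_finset_zero (s := {0})
      (f := fun m : ℤ => if m = 0 then ‖dpiece c (c + 2) S 0‖ else 0) fun m hm => ?_)).congr fun m => ?_
    · simp only [Finset.mem_singleton] at hm; simp [hm]
    · by_cases hm : m = 0
      · subst hm
        have h0 : dpiece c (c + 2) S' 0 = 0 := by simpa using hd1 0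
        simp [hg, h0]
      · simp [hg, hm]
  refine Summable.of_nonneg_of_le (fun m => norm_nonneg _) (fun m => ?_) hgs
  by_cases hm : m = 0
  · subst hm; simp [hg]
  · simp only [hg, hm, if_false]
    have hmR : (m : ℝ) ≠ 0 := by exact_mod_cast hm
    have hπm : 0 < π * |(m : ℝ)| := mul_pos Real.pi_pos (abs_pos.2 hmR)
    -- ‖D_{S′}(m)‖ = π |m| ‖D_S(m)‖
    have hnorm : ‖dpiece c (c + 2) S' m‖ = π * |(m : ℝ)| * ‖dpiece c (c + 2) S m‖ := by
      rw [hd1 m, norm_mul, norm_mul, norm_mul, Complex.norm_I, one_mul, Complex.norm_real, Real.norm_eq_abs,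
        abs_of_pos Real.pi_pos, Complex.norm_intCast]
    -- AM–GM: x ≤ ((πm x)² + (πm)⁻²)/2
    set x : ℝ := ‖dpiece c (c + 2) S m‖ with hx
    have hx0 : 0 ≤ x := norm_nonneg _
    rw [hnorm]
    have hsq : (π * |(m:ℝ)|) ^ 2 = π ^ 2 * (m : ℝ) ^ 2 := by rw [mul_pow, sq_abs]
    have key : 0 ≤ (π * |(m:ℝ)| * x - 1 / (π * |(m:ℝ)|)) ^ 2 := sq_nonneg _
    have hne : π * |(m:ℝ)| ≠ 0 := hπm.ne'
    have expand : (π * |(m:ℝ)| * x - 1 / (π * |(m:ℝ)|)) ^ 2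
        = (π * |(m:ℝ)| * x) ^ 2 - 2 * x + 1 / (π * |(m:ℝ)|) ^ 2 := by
      field_simp
      ring
    rw [expand, hsq] at key
    have h1 : 1 / (π ^ 2 * (m:ℝ) ^ 2) = 1 / π ^ 2 * (1 / (m : ℝ) ^ 2) := by
      rw [one_div_mul_one_div]
    linarith [key, h1]

end Det

end Literature.NumberTheory.LFunctions.Zhang2022

end
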